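import Summits.ValiantsHypothesis.ValiantsHypothesis.Theorems.LacunarySymmetroidMatrixDescartesCensusTropicalKLawBridges

/-!
# Route «KPlusLogSqLaw» — SYMMETRIC tropical designs: dominant terms are involutions, and symmetric patchworking lifts them to
# the symmetric real row of the SAME format (toward crux `Lifting`, stmt-ValiantsHypothesis-19772)

HONEST FRAMING.  Helper lemmas in the tree's dominance vocabulary (`MatrixDescartes.Negative.tropWeight / termSign / IsDominant /
patchMatrix`); object-search cell `pub-symmetroid`, Conjecture-B route `KPlusLogSqLaw`.  Nothing here asserts `Lifting`,
`TropicalB`, `KPlusLogSqLaw`, `MatrixDescartes`, a Door-A numeral or anything about `VP ≠ VNP`.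

WHY (seat note HOME/val-sym-lift-p4/GAP-LIFT.md §3).  `Lifting` compares the real SYMMETRIC census `ζ(m,K)` with the tropical
census `T(m,K)` of GENERAL designs.  The only transfer that exists runs tropical → real (Viro patchworking, tree
`le_card_posRoots_patch`, which lands in NON-symmetric pencils, whence the `(2m, K+1)` doubling in `tropKPlusLogSqLaw_of_kPlusLogSqLaw`).
This file records the same-format symmetric version and the structural price of symmetry:
* `tropWeight_transpose`, `termSign_transpose` — for a design with SYMMETRIC valuations and signs, the transposed Leibniz term
  `(σ⁻¹, λ ∘ σ⁻¹)` has the same tropical weight and the same sign as `(σ, λ)`;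
* `isDominant_symm_involutive` — hence a UNIQUELY dominant term of a symmetric design is an involution with a class map that is
  constant on its 2-cycles (`σ (σ i) = i`, `λ (σ i) = λ i`): the symmetric tropical census lives on involutions (matchings), which
  is why it is smaller than the general one (cell: `T_sym(2,K) = 3K − 4` against `4K − 7`) — located, not a bound;
* `patchMatrix_isSymm` — symmetric data patchwork to symmetric coefficient matrices;
* `le_card_posRoots_patchMatrix` — the tree's patchworking theorem with its witness made explicit (the pencil IS `patchMatrix b v ε`
  at base `b = #terms + 1`);
* `symmDesign_le_of_posRootLawAt` — **symmetric patchworking at the same format**: `PosRootLawAt m K B` bounds the number of sign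
  alternations of every dominant chain of every SYMMETRIC design of format `(m, K)` by `B`.  Contrapositive use: an explicit
  symmetric design with `n` alternations is a kernel certificate of `¬ PosRootLawAt m K (n − 1)` (a real census LOWER bound) at the
  same format, with no doubling. [folklore]
-/

-- `Summit.ValiantsHypothesis.ValiantsHypothesis.…` repeats a component by the D-0017 layout
-- (single-conjunct summit), which the `dupNamespace` linter flags; the name is mandated.
set_option linter.dupNamespace false
set_option autoImplicit false

namespace Summit.ValiantsHypothesis.ValiantsHypothesis.Theorems.LacunarySymmetroidMatrixDescartes.TropicalCensus

open Summit.ValiantsHypothesis.ValiantsHypothesis.Theorems.MatrixDescartes.Negative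
open Summit.ValiantsHypothesis.ValiantsHypothesis.Theorems.LacunarySymmetroidMatrixDescartes
open scoped BigOperators
open Finset Polynomial

variable {m K : ℕ}

/-! ## 1. The transposed term of a symmetric design -/

/-- With symmetric valuations, the transposed term `(σ⁻¹, λ ∘ σ⁻¹)` (its cells are the transposes `(i, σ i)` of the cells
`(σ i, i)`) has the same tropical weight. [folklore] -/
theorem tropWeight_transpose (d : Fin K → ℕ) (v : Fin m → Fin m → Fin K → ℤ) (hv : ∀ i j l, v i j l = v j i l) (θ : ℤ)
    (σ : Equiv.Perm (Fin m)) (lam : Fin m → Fin K) :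
    tropWeight d v θ (σ⁻¹, fun j => lam (σ⁻¹ j)) = tropWeight d v θ (σ, lam) := by
  unfold tropWeight
  have h1 : ∑ j, (d (lam (σ⁻¹ j)) : ℤ) = ∑ i, (d (lam i) : ℤ) :=
    Equiv.sum_comp σ⁻¹ (fun i => (d (lam i) : ℤ))
  have h2 : ∑ j, v (σ⁻¹ j) j (lam (σ⁻¹ j)) = ∑ i, v (σ i) i (lam i) := by
    rw [← Equiv.sum_comp σ (fun j => v (σ⁻¹ j) j (lam (σ⁻¹ j)))]
    refine Finset.sum_congr rfl fun i _ => ?_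
    rw [Equiv.Perm.inv_def, Equiv.symm_apply_apply]
    exact hv _ _ _
  simp only []
  rw [h1, h2]

/-- With symmetric signs, the transposed term has the same sign (`sign σ⁻¹ = sign σ`). [folklore] -/
theorem termSign_transpose (ε : Fin m → Fin m → Fin K → ℤ) (hε : ∀ i j l, ε i j l = ε j i l)
    (σ : Equiv.Perm (Fin m)) (lam : Fin m → Fin K) :
    termSign ε (σ⁻¹, fun j => lam (σ⁻¹ j)) = termSign ε (σ, lam) := by
  unfold termSign
  have h2 : ∏ j, ε (σ⁻¹ j) j (lam (σ⁻¹ j)) = ∏ i, ε (σ i) i (lam i) := by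
    rw [← Equiv.prod_comp σ (fun j => ε (σ⁻¹ j) j (lam (σ⁻¹ j)))]
    refine Finset.prod_congr rfl fun i _ => ?_
    rw [Equiv.Perm.inv_def, Equiv.symm_apply_apply]
    exact hε _ _ _
  simp only []
  rw [h2, Equiv.Perm.sign_inv]

/-- **Dominant terms of a symmetric design are involutions with cycle-constant class maps.**  If valuations and signs are
symmetric and `(σ, λ)` is the UNIQUE optimum at some slope, then `σ (σ i) = i` and `λ (σ i) = λ i` for all `i` (otherwise the
transposed term is a different term of the same weight and sign). [folklore] -/
theorem isDominant_symm_involutive (d : Fin K → ℕ) (v ε : Fin m → Fin m → Fin K → ℤ)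
    (hv : ∀ i j l, v i j l = v j i l) (hε : ∀ i j l, ε i j l = ε j i l) (θ : ℤ)
    (σ : Equiv.Perm (Fin m)) (lam : Fin m → Fin K) (h : IsDominant d v ε θ (σ, lam)) :
    (∀ i, σ (σ i) = i) ∧ ∀ i, lam (σ i) = lam i := by
  -- the transposed term cannot be a different term
  have heq : ((σ⁻¹, fun j => lam (σ⁻¹ j)) : Equiv.Perm (Fin m) × (Fin m → Fin K)) = (σ, lam) := by
    by_contra hne
    have hpres : termSign ε (σ⁻¹, fun j => lam (σ⁻¹ j)) ≠ 0 := by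
      rw [termSign_transpose ε hε]; exact h.1
    have hlt := h.2 _ hne hpres
    rw [tropWeight_transpose d v hv] at hlt
    exact lt_irrefl _ hlt
  have hσ : σ⁻¹ = σ := congrArg Prod.fst heq
  have hl : (fun j => lam (σ⁻¹ j)) = lam := congrArg Prod.snd heq
  refine ⟨fun i => ?_, fun i => ?_⟩
  · have := congrArg (fun τ : Equiv.Perm (Fin m) => τ (σ i)) hσ
    simpa using this.symm
  · have := congrFun hl (σ i)
    simpa using this.symm

/-! ## 2. Symmetric patchworking at the same format -/

/-- symmetric data patchwork to symmetric coefficient matrices. [folklore] -/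
theorem patchMatrix_isSymm (b : ℝ) (v ε : Fin m → Fin m → Fin K → ℤ) (hv : ∀ i j l, v i j l = v j i l)
    (hε : ∀ i j l, ε i j l = ε j i l) (l : Fin K) : (patchMatrix b v ε l).IsSymm := by
  ext i j
  simp only [Matrix.transpose_apply, patchMatrix]
  rw [hv j i l, hε j i l]

/-- **Patchworking with the explicit witness** (the tree's `le_card_posRoots_patch`, same proof, pencil named): a design with
`B + 1` uniquely dominant terms of alternating signs at increasing integer slopes gives `B` distinct positive zeros of the
determinant of the patchworked pencil `patchMatrix b v ε` at base `b = #terms + 1`. [folklore] -/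
theorem le_card_posRoots_patchMatrix (d : Fin K → ℕ) (v ε : Fin m → Fin m → Fin K → ℤ)
    (hε : ∀ i j l, (ε i j l).natAbs ≤ 1) {B : ℕ} (θ : Fin (B + 1) → ℤ) (hθ : StrictMono θ)
    (p : Fin (B + 1) → Equiv.Perm (Fin m) × (Fin m → Fin K))
    (hdom : ∀ k, IsDominant d v ε (θ k) (p k))
    (halt : ∀ k : Fin B, termSign ε (p k.castSucc) * termSign ε (p k.succ) < 0) :
    B ≤ ((∑ l, (X : ℝ[X]) ^ d l •
      (patchMatrix ((Fintype.card (Equiv.Perm (Fin m) × (Fin m → Fin K)) : ℝ) + 1) v ε l).map Polynomial.C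
        ).det.roots.toFinset.filter (fun t => 0 < t)).card := by
  set b : ℝ := (Fintype.card (Equiv.Perm (Fin m) × (Fin m → Fin K)) : ℝ) + 1 with hbdef
  have hb : (Fintype.card (Equiv.Perm (Fin m) × (Fin m → Fin K)) : ℝ) < b := by rw [hbdef]; linarith
  have hb1 : 1 < b := by
    have : (1 : ℝ) ≤ Fintype.card (Equiv.Perm (Fin m) × (Fin m → Fin K)) := by
      exact_mod_cast (Fintype.card_pos_iff.mpr ⟨p 0⟩ : 0 < Fintype.card (Equiv.Perm (Fin m) × (Fin m → Fin K)))
    linarith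
  have hb0 : 0 < b := lt_trans zero_lt_one hb1
  let τ : Fin (B + 1) → ℝ := fun k => b ^ θ k
  have hτmono : StrictMono τ := fun i j hij => zpow_lt_zpow_right₀ hb1 (hθ hij)
  have hτpos : ∀ k, 0 < τ k := fun k => zpow_pos hb0 _
  refine Summit.ValiantsHypothesis.ValiantsHypothesis.Theorems.SymmetroidDescartes.le_card_posRoots_of_alternating
    _ B τ hτmono hτpos fun k => ?_
  rw [Summit.ValiantsHypothesis.ValiantsHypothesis.Theorems.SymmetroidDescartes.eval_det_pencil,
    Summit.ValiantsHypothesis.ValiantsHypothesis.Theorems.SymmetroidDescartes.eval_det_pencil]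
  exact det_patch_alternates b d v ε hε θ p hdom halt hb k

/-- **Symmetric patchworking at the same format.**  The positive-zeros row `PosRootLawAt m K B` («`ζ₊(m,K) ≤ B`») bounds by `B`
the number of sign alternations of every dominant chain of every SYMMETRIC design (symmetric valuations and signs) of format
`(m, K)`: the patchworked pencil is symmetric and has at least that many distinct positive zeros.  (For general designs the
tree has to double the format: `tropKPlusLogSqLaw_of_kPlusLogSqLaw`.) [folklore] -/
theorem symmDesign_le_of_posRootLawAt {B : ℕ} (hrow : PosRootLawAt m K B)
    (d : Fin K → ℕ) (v ε : Fin m → Fin m → Fin K → ℤ)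
    (hv : ∀ i j l, v i j l = v j i l) (hεs : ∀ i j l, ε i j l = ε j i l) (hε : ∀ i j l, (ε i j l).natAbs ≤ 1)
    {n : ℕ} (θ : Fin (n + 1) → ℤ) (hθ : StrictMono θ) (p : Fin (n + 1) → Equiv.Perm (Fin m) × (Fin m → Fin K))
    (hdom : ∀ k, IsDominant d v ε (θ k) (p k))
    (halt : ∀ k : Fin n, termSign ε (p k.castSucc) * termSign ε (p k.succ) < 0) : n ≤ B :=
  (le_card_posRoots_patchMatrix d v ε hε θ hθ p hdom halt).trans
    (hrow d _ (patchMatrix_isSymm _ v ε hv hεs))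

end Summit.ValiantsHypothesis.ValiantsHypothesis.Theorems.LacunarySymmetroidMatrixDescartes.TropicalCensus
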